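import Mathlib
import HarnessLib
import Literature.Analysis.FluidPDE.NSBoundedHigherRegularityQuantProofs
import Literature.Analysis.FluidPDE.DerivativeHolderInterpolation
import Literature.Analysis.FluidPDE.TaoEnstrophyLocalisation
import Summits.NavierStokesRegularity.NavierStokesRegularity.Theorems.RellichScarTypeIBlowupProfile
import Summits.NavierStokesRegularity.NavierStokesRegularity.Theorems.LocalSineTubeDoorProfileAlignedWindowRigidityAncient
import Summits.NavierStokesRegularity.NavierStokesRegularity.Theorems.LocalSineTubeDoorLocalPointZoomUpgrade
import Summits.NavierStokesRegularity.NavierStokesRegularity.Theorems.LocalSineTubeDoorLocalPointZoomData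

/-!
# Route `LocalSineTubeDoor`, zoom item `LocalPointZoom` (stmt-NavierStokesRegularity-20017) — support: LOCALLY UNIFORM
# (space–time) convergence of the rescaled velocities and gradients near the slice `s = −1`, and convergence of the
# SECOND derivatives at the slice

Cell ns-regularity-ideate, seat p6 (route-directed support, `--supports stmt-NavierStokesRegularity-20017`).  The same
Seregin–Šverák equi-Hölder + Landau machine as `…LocalPointZoomCurl` / `…LocalPointZoomGrad`, run uniformly: the level-zero
upgrade (`uniform_of_L3_of_holder`) is applied on the space–time ball `B((−1, y), 1/8)` (whose `1/8`-neighbourhood lies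
in the cylinder `Q((−½, y), 7/8)`), the two-function Landau inequality (`DerivInterp.norm_iteratedFDeriv_succ_sub_le`)
is applied at EVERY point of `B((−1, y), 1/16)` (uniform `C²` bounds for the representatives from
`NSBoundedHigherRegularityBounds_holds`, for the profile from joint analyticity via
`IsSmoothSpaceTimeOn.exists_bound_iteratedFDeriv`), and then once more at `(−1, y)` with `k = 1` (uniform `C³` bounds):

* `localZoomFrame_uniform` — (U0) `Zⱼ → v₁` uniformly on `B((−1, y), 1/8)`; (U1) `D Zⱼ(s,·)(y') → D v₁(s,·)(y')`
  uniformly for `(s, y') ∈ B((−1, y), 1/16)`; (H) `D² Zⱼ(−1,·)(y) → D² v₁(−1,·)(y)`.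

PURPOSE: (U0)/(U1) give DIAGONAL convergence `Zⱼ(sⱼ, yⱼ) → v₁(s, y)` for `(sⱼ, yⱼ) → (s, y)` (needed by sequential /
most-times versions of the one-window doors, cf. the cell's FlexibleZoom for ScaledTopAlignment), and (H) is the first
step towards SECOND-ORDER window doors (scalars built from `u, ∇u, ∇²u`, e.g. the super-helicity `ω · curl ω`).

WHAT THIS IS NOT: not a claim about Navier–Stokes regularity; a compactness/regularity lemma for door routes
(bears_on LADDER-NS N0).
-/

noncomputable section

-- the summit and its single sub-problem share the name (CONVENTIONS §1), as in every Theorems file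
set_option linter.dupNamespace false

namespace Summit.NavierStokesRegularity.NavierStokesRegularity.Theorems.LocalSineTubeDoorLocalPointZoomUniform

open MeasureTheory Set Function Filter Topology TopologicalSpace Metric
open Literature.Analysis Literature.Analysis.FluidPDE Literature.Analysis.FluidPDE.SereginSverak2009
open Summit.NavierStokesRegularity.NavierStokesRegularity.Theorems
open Summit.NavierStokesRegularity.NavierStokesRegularity.Theorems.LocalSineTubeDoorProfileAlignedWindowRigidityAncient
open Summit.NavierStokesRegularity.NavierStokesRegularity.Theorems.LocalSineTubeDoorLocalPointZoomUpgrade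
open Summit.NavierStokesRegularity.NavierStokesRegularity.Theorems.LocalSineTubeDoorLocalPointZoomData
open scoped NNReal ENNReal

set_option maxHeartbeats 400000 in
/-- **Locally uniform zoom convergence near the slice `s = −1`, and second derivatives at the slice** (see the module
docstring): (U0) level zero uniformly on the space–time ball `B((−1,y),1/8)`, (U1) gradients uniformly on `B((−1,y),1/16)`,
(H) Hessians at `(−1, y)`. -/
theorem localZoomFrame_uniform {ν T : ℝ} (hν : 0 < ν) (hT : 0 < T) {u : ℝ → (EuclideanSpace ℝ (Fin 3)) → (EuclideanSpace ℝ (Fin 3))}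
    (hcont : ContinuousOn (uncurry u) (Ico 0 T ×ˢ univ)) {x₀ : (EuclideanSpace ℝ (Fin 3))} {ρ M : ℝ} (hρ : 0 < ρ)
    (hM : ∀ t ∈ Ico 0 T, T - ρ ^ 2 < t → ∀ x ∈ ball x₀ ρ, ‖u t x‖ * Real.sqrt (ν * (T - t)) ≤ M)
    {R : ℝ} (hR : 0 < R) {v' : ℝ → (EuclideanSpace ℝ (Fin 3)) → (EuclideanSpace ℝ (Fin 3))} {π' : ℝ → (EuclideanSpace ℝ (Fin 3)) → ℝ}
    (hball1 : IsSuitableWeakSolutionInBall 1 0 v' π') {lam : ℕ → ℝ} (hlam : ∀ j, 0 < lam j)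
    (hlam0 : Tendsto lam atTop (𝓝 0)) {Ks : ℝ≥0} {r₁ : ℝ} (hr₁ : 0 < r₁) (hr₁1 : r₁ ≤ 1)
    (hKs : ∀ r ∈ Ioc (0 : ℝ) r₁, cknD r (0 : ℝ × (EuclideanSpace ℝ (Fin 3))) π' ≤ Ks)
    (hpt : ∀ (j : ℕ) (s : ℝ) (y : (EuclideanSpace ℝ (Fin 3))), ((lam j) • stPull ((lam j) ^ 2) (lam j) (0 : ℝ) (0 : (EuclideanSpace ℝ (Fin 3))) v') s y =
      ((R * (lam j / 2)) / ν) • u (T + (R * (lam j / 2)) ^ 2 * s / ν) (x₀ + (R * (lam j / 2)) • y))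
    {w v₁ : ℝ → (EuclideanSpace ℝ (Fin 3)) → (EuclideanSpace ℝ (Fin 3))}
    (hL3 : ∀ a : ℝ, 0 < a → Tendsto (fun j => eLpNorm (uncurry ((lam j) • stPull ((lam j) ^ 2) (lam j) (0 : ℝ) (0 : (EuclideanSpace ℝ (Fin 3))) v') - uncurry w) 3
      (volume.restrict (parabolicCylinder a (0 : ℝ × (EuclideanSpace ℝ (Fin 3)))))) atTop (𝓝 0))
    (hae : ∀ᵐ x ∂(volume.restrict (Iio (0 : ℝ) ×ˢ (univ : Set (EuclideanSpace ℝ (Fin 3))))), uncurry w x = uncurry v₁ x)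
    {C₁ : ℝ} (hv₁rate : HasTypeITimeDecay C₁ v₁) (hv₁cont : ContinuousOn (uncurry v₁) (Iio (0 : ℝ) ×ˢ univ))
    (hv₁mild : ∀ s t : ℝ, s < t → t < 0 → ∀ x,
      v₁ t x = UnboundedOperators.heatExtension (v₁ s) (t - s) x - oseenDuhamel 1 s v₁ v₁ t x)
    (y : (EuclideanSpace ℝ (Fin 3))) :
    (∀ ε > 0, ∀ᶠ j in atTop, ∀ w ∈ ball (((-1 : ℝ), y) : ℝ × EuclideanSpace ℝ (Fin 3)) (1 / 8),
      ‖((lam j) • stPull ((lam j) ^ 2) (lam j) (0 : ℝ) (0 : (EuclideanSpace ℝ (Fin 3))) v') w.1 w.2 - v₁ w.1 w.2‖ < ε) ∧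
    (∀ ε > 0, ∀ᶠ j in atTop, ∀ w ∈ ball (((-1 : ℝ), y) : ℝ × EuclideanSpace ℝ (Fin 3)) (1 / 16),
      ‖fderiv ℝ (((lam j) • stPull ((lam j) ^ 2) (lam j) (0 : ℝ) (0 : (EuclideanSpace ℝ (Fin 3))) v') w.1) w.2 -
        fderiv ℝ (v₁ w.1) w.2‖ < ε) ∧
    Tendsto (fun j => iteratedFDeriv ℝ 2 (((lam j) • stPull ((lam j) ^ 2) (lam j) (0 : ℝ) (0 : (EuclideanSpace ℝ (Fin 3))) v') (-1)) y)
      atTop (𝓝 (iteratedFDeriv ℝ 2 (v₁ (-1)) y)) := by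
  obtain ⟨J, hJ⟩ := localZoomFrame_data hν hT hρ hM hR hball1 hlam hlam0 hr₁ hr₁1 hKs hpt y
  have hΛpos : ∀ j, 0 < (R * (lam j / 2)) := fun j => mul_pos hR (half_pos (hlam j))
  have hZpt : ∀ (j : ℕ) (s : ℝ) (y' : (EuclideanSpace ℝ (Fin 3))),
      ((lam j) • stPull ((lam j) ^ 2) (lam j) (0 : ℝ) (0 : (EuclideanSpace ℝ (Fin 3))) v') s y' = ((R * (lam j / 2)) / ν) • u (T + (R * (lam j / 2)) ^ 2 * s / ν) (x₀ + (R * (lam j / 2)) • y') :=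
    hpt
  set a : ℝ := ‖y‖ + 2 with ha_def
  have ha : 0 < a := by positivity
  have hmemQ : ∀ {r : ℝ} {w : ℝ × (EuclideanSpace ℝ (Fin 3))},
      w ∈ parabolicCylinder r ((-(1 / 2) : ℝ), y) ↔
        (-(1 / 2) - r ^ 2 < w.1 ∧ w.1 < -(1 / 2)) ∧ dist w.2 y < r := by
    intro r w
    simp only [parabolicCylinder, mem_prod, mem_Ioo, mem_ball]
  have htime : ∀ j, J ≤ j → ∀ s : ℝ, -(3 / 2) < s → s < -(1 / 2) →
      T + (R * (lam j / 2)) ^ 2 * s / ν ∈ Ico 0 T := by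
    intro j hj s hs1 hs2
    have hC := (hJ j hj).1
    have hΛ2 : 0 < (R * (lam j / 2)) ^ 2 := pow_pos (hΛpos j) 2
    refine ⟨?_, ?_⟩
    · have key : 0 ≤ ν * T + (R * (lam j / 2)) ^ 2 * s := by nlinarith
      have e : T + (R * (lam j / 2)) ^ 2 * s / ν = (ν * T + (R * (lam j / 2)) ^ 2 * s) / ν := by
        field_simp
      rw [e]
      exact div_nonneg key hν.le
    · have : (R * (lam j / 2)) ^ 2 * s / ν < 0 := div_neg_of_neg_of_pos (by nlinarith) hν
      linarith
  -- ## Seregin–Šverák §2 p. 8: equi-Hölder smooth representatives with uniform bounds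
  obtain ⟨Kr, Cr, αr, hαr, hreg⟩ := NSBoundedHigherRegularityBounds_holds (1 : ℝ)
    (M * Real.sqrt 2 / ν) (((‖y‖ + 2) ^ 2).toNNReal * Ks)
  have hch : ∀ j, ∃ V : ℝ → (EuclideanSpace ℝ (Fin 3)) → (EuclideanSpace ℝ (Fin 3)), J ≤ j →
      (uncurry ((lam j) • stPull ((lam j) ^ 2) (lam j) (0 : ℝ) (0 : (EuclideanSpace ℝ (Fin 3))) v') =ᵐ[volume.restrict (parabolicCylinder 1 ((-(1 / 2) : ℝ), y))] uncurry V) ∧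
      (∀ w ∈ parabolicCylinder 1 ((-(1 / 2) : ℝ), y), ContDiffAt ℝ (⊤ : ℕ∞) (V w.1) w.2) ∧
      ∀ n : ℕ, ∀ r ∈ Ioo (0 : ℝ) 1,
        HolderOnWith (Cr n r) (αr n r) (fun w : ℝ × (EuclideanSpace ℝ (Fin 3)) => iteratedFDeriv ℝ n (V w.1) w.2)
          (parabolicCylinder r ((-(1 / 2) : ℝ), y)) ∧
        ∀ w ∈ parabolicCylinder r ((-(1 / 2) : ℝ), y), ‖iteratedFDeriv ℝ n (V w.1) w.2‖ ≤ Kr n r := by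
    intro j
    by_cases hj : J ≤ j
    · obtain ⟨V, hV⟩ := hreg ((lam j) • stPull ((lam j) ^ 2) (lam j) (0 : ℝ) (0 : (EuclideanSpace ℝ (Fin 3))) v') ((lam j) ^ 2 • stPull ((lam j) ^ 2) (lam j) (0 : ℝ) (0 : (EuclideanSpace ℝ (Fin 3))) π') ((-(1 / 2) : ℝ), y) (hJ j hj).2.1 (hJ j hj).2.2.1 (hJ j hj).2.2.2
      exact ⟨V, fun _ => hV⟩
    · exact ⟨fun _ _ => 0, fun h => absurd h hj⟩
  choose V hV using hch
  -- ## cylinders about the slice `s = -1`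
  have h78 : (7 / 8 : ℝ) ∈ Ioo (0 : ℝ) 1 := ⟨by norm_num, by norm_num⟩
  have hQ71 : parabolicCylinder (7 / 8) ((-(1 / 2) : ℝ), y) ⊆
      parabolicCylinder 1 ((-(1 / 2) : ℝ), y) := by
    intro w hw
    rw [hmemQ] at hw ⊢
    obtain ⟨⟨h1, h2⟩, h3⟩ := hw
    exact ⟨⟨by linarith, h2⟩, by linarith⟩
  have hQ7a : parabolicCylinder (7 / 8) ((-(1 / 2) : ℝ), y) ⊆ parabolicCylinder a (0 : ℝ × (EuclideanSpace ℝ (Fin 3))) := by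
    intro w hw
    rw [hmemQ] at hw
    obtain ⟨⟨h1, h2⟩, h3⟩ := hw
    have ha2 : 2 ≤ a := by rw [ha_def]; linarith [norm_nonneg y]
    have ha4 : 4 ≤ a ^ 2 := by nlinarith
    simp only [parabolicCylinder, mem_prod, mem_Ioo, mem_ball, Prod.fst_zero, Prod.snd_zero,
      zero_sub, dist_zero_right]
    refine ⟨⟨by linarith, by linarith⟩, ?_⟩
    calc ‖w.2‖ ≤ dist w.2 y + ‖y‖ := by simpa [dist_zero_right] using dist_triangle w.2 y 0
      _ < a := by rw [ha_def]; linarith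
  have hQ7slab : parabolicCylinder (7 / 8) ((-(1 / 2) : ℝ), y) ⊆ Iio (0 : ℝ) ×ˢ univ := by
    intro w hw
    rw [hmemQ] at hw
    exact mem_prod.2 ⟨by simpa using (by linarith [hw.1.2] : w.1 < 0), mem_univ _⟩
  have hmem1 : ∀ y' ∈ ball y (1 / 4), ((-1 : ℝ), y') ∈ parabolicCylinder 1 ((-(1 / 2) : ℝ), y) := by
    intro y' hy'
    rw [hmemQ]
    exact ⟨⟨by norm_num, by norm_num⟩, by linarith [mem_ball.1 hy']⟩
  have hmem7 : ∀ y' ∈ ball y (7 / 8),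
      ((-1 : ℝ), y') ∈ parabolicCylinder (7 / 8) ((-(1 / 2) : ℝ), y) := by
    intro y' hy'
    rw [hmemQ]
    exact ⟨⟨by norm_num, by norm_num⟩, mem_ball.1 hy'⟩
  -- ## `V j = zoom` on `Q(z, 7/8)` (both continuous), hence equal gradients at `(-1, y)`
  have hZcont : ∀ j, J ≤ j → ContinuousOn (uncurry ((lam j) • stPull ((lam j) ^ 2) (lam j) (0 : ℝ) (0 : (EuclideanSpace ℝ (Fin 3))) v')) (parabolicCylinder 1 ((-(1 / 2) : ℝ), y)) := by
    intro j hj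
    have hφ : Continuous fun w : ℝ × (EuclideanSpace ℝ (Fin 3)) => (T + (R * (lam j / 2)) ^ 2 * w.1 / ν, x₀ + (R * (lam j / 2)) • w.2) := by
      fun_prop
    have hmaps : MapsTo (fun w : ℝ × (EuclideanSpace ℝ (Fin 3)) => (T + (R * (lam j / 2)) ^ 2 * w.1 / ν, x₀ + (R * (lam j / 2)) • w.2))
        (parabolicCylinder 1 ((-(1 / 2) : ℝ), y)) (Ico 0 T ×ˢ univ) := by
      intro w hw
      rw [hmemQ] at hw
      exact mem_prod.2 ⟨htime j hj w.1 (by linarith [hw.1.1]) hw.1.2, mem_univ _⟩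
    have hc := (hcont.comp hφ.continuousOn hmaps).const_smul ((R * (lam j / 2)) / ν)
    refine hc.congr fun w _ => ?_
    exact hZpt j w.1 w.2
  have hVH : ∀ j, J ≤ j → HolderOnWith (Cr 0 (7 / 8)) (αr 0 (7 / 8))
      (fun w : ℝ × (EuclideanSpace ℝ (Fin 3)) => V j w.1 w.2) (parabolicCylinder (7 / 8) ((-(1 / 2) : ℝ), y)) := by
    intro j hj w hw w' hw'
    have h := ((hV j hj).2.2 0 (7 / 8) h78).1 w hw w' hw'
    simpa only [iteratedFDeriv_zero_eq_comp, Function.comp_apply, LinearIsometryEquiv.edist_map]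
      using h
  have hVcont : ∀ j, J ≤ j → ContinuousOn (uncurry (V j))
      (parabolicCylinder (7 / 8) ((-(1 / 2) : ℝ), y)) := fun j hj =>
    ((hVH j hj).uniformContinuousOn (hαr 0 (7 / 8) h78)).continuousOn
  have hEqOn : ∀ j, J ≤ j → EqOn (uncurry ((lam j) • stPull ((lam j) ^ 2) (lam j) (0 : ℝ) (0 : (EuclideanSpace ℝ (Fin 3))) v')) (uncurry (V j))
      (parabolicCylinder (7 / 8) ((-(1 / 2) : ℝ), y)) := fun j hj =>
    Measure.eqOn_open_of_ae_eq (ae_restrict_of_ae_restrict_of_subset hQ71 (hV j hj).1)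
      (isOpen_parabolicCylinder _ _) ((hZcont j hj).mono hQ71) (hVcont j hj)
  have hfderiv : ∀ j, J ≤ j → fderiv ℝ (((lam j) • stPull ((lam j) ^ 2) (lam j) (0 : ℝ) (0 : (EuclideanSpace ℝ (Fin 3))) v') (-1)) y = fderiv ℝ (V j (-1)) y := by
    intro j hj
    refine Filter.EventuallyEq.fderiv_eq ?_
    filter_upwards [ball_mem_nhds y (by norm_num : (0 : ℝ) < 7 / 8)] with y' hy'
    exact hEqOn j hj (hmem7 y' hy')
  -- ## level zero: `V j (-1, ·) → v₁ (-1, ·)` uniformly on `ball y (1/4)`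
  have hHol : ∀ᶠ j in atTop, HolderOnWith (Cr 0 (7 / 8)) (αr 0 (7 / 8))
      (fun w : ℝ × (EuclideanSpace ℝ (Fin 3)) => V j w.1 w.2) (parabolicCylinder (7 / 8) ((-(1 / 2) : ℝ), y)) := by
    filter_upwards [eventually_ge_atTop J] with j hj
    exact hVH j hj
  have hUC : UniformContinuousOn (fun w : ℝ × (EuclideanSpace ℝ (Fin 3)) => v₁ w.1 w.2)
      (parabolicCylinder (7 / 8) ((-(1 / 2) : ℝ), y)) := by
    have hKc : IsCompact (Icc (-2 : ℝ) (-(1 / 4)) ×ˢ closedBall y 1) :=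
      isCompact_Icc.prod (isCompact_closedBall y 1)
    have hKslab : Icc (-2 : ℝ) (-(1 / 4)) ×ˢ closedBall y 1 ⊆ Iio (0 : ℝ) ×ˢ univ := by
      intro w hw
      have h := (mem_Icc.1 (mem_prod.1 hw).1).2
      exact mem_prod.2 ⟨by simpa using (by linarith : w.1 < 0), mem_univ _⟩
    have hQK : parabolicCylinder (7 / 8) ((-(1 / 2) : ℝ), y) ⊆
        Icc (-2 : ℝ) (-(1 / 4)) ×ˢ closedBall y 1 := by
      intro w hw
      rw [hmemQ] at hw
      obtain ⟨⟨h1, h2⟩, h3⟩ := hw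
      exact mem_prod.2 ⟨⟨by linarith, by linarith⟩, mem_closedBall.2 (by linarith)⟩
    exact (hKc.uniformContinuousOn_of_continuous (hv₁cont.mono hKslab)).mono hQK
  have hL3' : Tendsto (fun j => eLpNorm (fun w : ℝ × (EuclideanSpace ℝ (Fin 3)) => V j w.1 w.2 - v₁ w.1 w.2) 3
      (volume.restrict (parabolicCylinder (7 / 8) ((-(1 / 2) : ℝ), y)))) atTop (𝓝 0) := by
    have h3 := hL3 a ha
    refine tendsto_of_tendsto_of_tendsto_of_le_of_le' tendsto_const_nhds h3
      (Eventually.of_forall fun _ => zero_le) ?_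
    filter_upwards [eventually_ge_atTop J] with j hj
    have hae1 : ∀ᵐ x ∂(volume.restrict (parabolicCylinder (7 / 8) ((-(1 / 2) : ℝ), y))),
        uncurry ((lam j) • stPull ((lam j) ^ 2) (lam j) (0 : ℝ) (0 : (EuclideanSpace ℝ (Fin 3))) v') x = uncurry (V j) x := ae_restrict_of_ae_restrict_of_subset hQ71 (hV j hj).1
    have hae2 : ∀ᵐ x ∂(volume.restrict (parabolicCylinder (7 / 8) ((-(1 / 2) : ℝ), y))),
        uncurry w x = uncurry v₁ x := ae_restrict_of_ae_restrict_of_subset hQ7slab hae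
    calc eLpNorm (fun w : ℝ × (EuclideanSpace ℝ (Fin 3)) => V j w.1 w.2 - v₁ w.1 w.2) 3
          (volume.restrict (parabolicCylinder (7 / 8) ((-(1 / 2) : ℝ), y)))
        = eLpNorm (uncurry ((lam j) • stPull ((lam j) ^ 2) (lam j) (0 : ℝ) (0 : (EuclideanSpace ℝ (Fin 3))) v') - uncurry w) 3
          (volume.restrict (parabolicCylinder (7 / 8) ((-(1 / 2) : ℝ), y))) := by
          refine eLpNorm_congr_ae ?_
          filter_upwards [hae1, hae2] with x hx1 hx2
          rw [Pi.sub_apply, hx1, hx2]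
          rfl
      _ ≤ eLpNorm (uncurry ((lam j) • stPull ((lam j) ^ 2) (lam j) (0 : ℝ) (0 : (EuclideanSpace ℝ (Fin 3))) v') - uncurry w) 3
          (volume.restrict (parabolicCylinder a (0 : ℝ × (EuclideanSpace ℝ (Fin 3))))) :=
          eLpNorm_mono_measure _ (Measure.restrict_mono hQ7a le_rfl)
  -- ## the space–time ball `B((−1, y), 1/8)` has its `1/8`-neighbourhood inside `Q(z, 7/8)`
  set S₈ : Set (ℝ × (EuclideanSpace ℝ (Fin 3))) := ball (((-1 : ℝ), y) : ℝ × EuclideanSpace ℝ (Fin 3)) (1 / 8)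
    with hS₈def
  have hmemB : ∀ {c : ℝ × (EuclideanSpace ℝ (Fin 3))} {r : ℝ} {w : ℝ × (EuclideanSpace ℝ (Fin 3))},
      w ∈ ball c r ↔ |w.1 - c.1| < r ∧ dist w.2 c.2 < r := by
    intro c r w
    rw [mem_ball, Prod.dist_eq, max_lt_iff, Real.dist_eq]
  have hS8Q : ∀ w ∈ S₈, ball w (1 / 8) ⊆ parabolicCylinder (7 / 8) ((-(1 / 2) : ℝ), y) := by
    intro w hw w' hw'
    rw [hS₈def, hmemB] at hw
    rw [hmemB] at hw'
    obtain ⟨hw1, hw2⟩ := hw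
    obtain ⟨hw1', hw2'⟩ := hw'
    rw [hmemQ]
    have h1 := abs_lt.1 hw1
    have h1' := abs_lt.1 hw1'
    refine ⟨⟨by norm_num at h1 h1' ⊢; linarith, by norm_num at h1 h1' ⊢; linarith⟩, ?_⟩
    calc dist w'.2 y ≤ dist w'.2 w.2 + dist w.2 y := dist_triangle _ _ _
      _ < 1 / 8 + 1 / 8 := add_lt_add hw2' (by simpa using hw2)
      _ < 7 / 8 := by norm_num
  have hS8sub : S₈ ⊆ parabolicCylinder (7 / 8) ((-(1 / 2) : ℝ), y) := fun w hw =>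
    hS8Q w hw (mem_ball_self (by norm_num))
  have hU := uniform_of_L3_of_holder (isOpen_parabolicCylinder _ _) (hαr 0 (7 / 8) h78) hHol hUC
    hL3' (by norm_num : (0 : ℝ) < 1 / 8) hS8Q
  -- ## smoothness data of the profile `v₁` near the slice
  have hv₁an : AnalyticOnNhd ℝ (uncurry v₁) (Iio (0 : ℝ) ×ˢ univ) :=
    analyticOnNhd_uncurry hv₁cont (bdd_of_hasTypeITimeDecay hv₁rate) hv₁mild
  have hsm : IsSmoothSpaceTimeOn (Icc (-(9 / 8) : ℝ) (-(7 / 8))) v₁ := by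
    have h1 : ContDiffOn ℝ (⊤ : ℕ∞) (uncurry v₁) (Iio (0 : ℝ) ×ˢ univ) := hv₁an.contDiffOn_of_completeSpace
    exact h1.mono (prod_mono (fun t ht => by simp only [mem_Iio]; linarith [(mem_Icc.1 ht).2]) Subset.rfl)
  have hIcc : UniqueDiffOn ℝ (Icc (-(9 / 8) : ℝ) (-(7 / 8))) := uniqueDiffOn_Icc (by norm_num)
  obtain ⟨Kv2, hKv2⟩ := hsm.exists_bound_iteratedFDeriv isCompact_Icc hIcc (isCompact_closedBall y 1) 2
  obtain ⟨Kv3, hKv3⟩ := hsm.exists_bound_iteratedFDeriv isCompact_Icc hIcc (isCompact_closedBall y 1) 3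
  have hslice_cd : ∀ s : ℝ, s < 0 → ∀ y' : EuclideanSpace ℝ (Fin 3), ContDiffAt ℝ (⊤ : ℕ∞) (v₁ s) y' := by
    intro s hs y'
    exact ((analyticOnNhd_slice hv₁cont (bdd_of_hasTypeITimeDecay hv₁rate) hv₁mild hs).contDiff).contDiffAt
  -- ## one constant for all the Landau steps
  set K : ℝ := max (max (Kr 2 (7 / 8) : ℝ) (Kr 3 (7 / 8) : ℝ)) (max (max Kv2 Kv3) 0) with hKdef
  have hK0 : 0 ≤ K := le_trans (le_max_right _ _) (le_max_right _ _)
  have hKr2 : (Kr 2 (7 / 8) : ℝ) ≤ K := (le_max_left _ _).trans (le_max_left _ _)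
  have hKr3 : (Kr 3 (7 / 8) : ℝ) ≤ K := (le_max_right _ _).trans (le_max_left _ _)
  have hKv2K : Kv2 ≤ K := ((le_max_left _ _).trans (le_max_left _ _)).trans (le_max_right _ _)
  have hKv3K : Kv3 ≤ K := ((le_max_right _ _).trans (le_max_left _ _)).trans (le_max_right _ _)
  -- ## (U1, for the representatives): level-one convergence, uniformly on `B((−1, y), 1/16)`
  have hU1 : ∀ ε > 0, ∀ᶠ j in atTop, ∀ w ∈ ball (((-1 : ℝ), y) : ℝ × EuclideanSpace ℝ (Fin 3)) (1 / 16),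
      ‖iteratedFDeriv ℝ 1 (V j w.1) w.2 - iteratedFDeriv ℝ 1 (v₁ w.1) w.2‖ ≤ ε := by
    intro ε hε
    obtain ⟨ρ, hρ0, hρh, hρK⟩ : ∃ ρ : ℝ, 0 < ρ ∧ ρ < 1 / 16 ∧ 2 * K * ρ ≤ ε / 2 := by
      refine ⟨min (1 / 32) (ε / (4 * (K + 1))), lt_min (by norm_num) (by positivity),
        lt_of_le_of_lt (min_le_left _ _) (by norm_num), ?_⟩
      calc 2 * K * min (1 / 32) (ε / (4 * (K + 1))) ≤ 2 * K * (ε / (4 * (K + 1))) := by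
            gcongr; exact min_le_right _ _
        _ = ε / 2 * (K / (K + 1)) := by field_simp; ring
        _ ≤ ε / 2 * 1 := by gcongr; exact (div_le_one (by positivity)).2 (by linarith)
        _ = ε / 2 := mul_one _
    set A : ℝ := ε * ρ / 4 with hAdef
    have hA0 : 0 < A := by positivity
    have hAρ : 2 * A / ρ = ε / 2 := by rw [hAdef]; field_simp; ring
    filter_upwards [hU A hA0, eventually_ge_atTop J] with j hUj hJj w hw
    have hVj := hV j hJj
    rw [hmemB] at hw
    obtain ⟨hw1, hw2⟩ := hw
    have h1 := abs_lt.1 hw1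
    have hw1neg : w.1 < 0 := by norm_num at h1; linarith
    have hI := DerivInterp.norm_iteratedFDeriv_succ_sub_le (N := ((⊤ : ℕ∞) : WithTop ℕ∞)) (k := 0)
      (h := 1 / 16) (x := w.2) (f₁ := V j w.1) (f₂ := v₁ w.1) (A := A) (K := K)
      (fun y' hy' => hVj.2.1 (w.1, y') ?_) (fun y' _ => hslice_cd w.1 hw1neg y')
      (by rw [← WithTop.coe_natCast]; exact WithTop.coe_le_coe.2 le_top)
      (fun y' hy' => ?_) hK0 (fun y' hy' => ?_) (fun y' hy' => ?_) hρ0 hρh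
    · calc ‖iteratedFDeriv ℝ 1 (V j w.1) w.2 - iteratedFDeriv ℝ 1 (v₁ w.1) w.2‖
          ≤ 2 * A / ρ + 2 * K * ρ := hI
        _ ≤ ε / 2 + ε / 2 := by rw [hAρ]; exact add_le_add le_rfl hρK
        _ = ε := by ring
    · rw [hmemQ]
      refine ⟨⟨by norm_num at h1 ⊢; linarith, by norm_num at h1 ⊢; linarith⟩, ?_⟩
      calc dist y' y ≤ dist y' w.2 + dist w.2 y := dist_triangle _ _ _
        _ < 1 / 16 + 1 / 16 := add_lt_add (mem_ball.1 hy') hw2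
        _ < 1 := by norm_num
    · rw [DerivInterp.norm_iteratedFDeriv_zero_sub]
      refine (hUj (w.1, y') ?_).le
      rw [hS₈def, hmemB]
      refine ⟨lt_trans hw1 (by norm_num), ?_⟩
      calc dist y' y ≤ dist y' w.2 + dist w.2 y := dist_triangle _ _ _
        _ < 1 / 16 + 1 / 16 := add_lt_add (mem_ball.1 hy') hw2
        _ = 1 / 8 := by norm_num
    · refine (((hVj.2.2 2 (7 / 8) h78).2 (w.1, y') ?_).trans hKr2)
      rw [hmemQ]
      refine ⟨⟨by norm_num at h1 ⊢; linarith, by norm_num at h1 ⊢; linarith⟩, ?_⟩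
      calc dist y' y ≤ dist y' w.2 + dist w.2 y := dist_triangle _ _ _
        _ < 1 / 16 + 1 / 16 := add_lt_add (mem_ball.1 hy') hw2
        _ < 7 / 8 := by norm_num
    · refine (hKv2 w.1 ⟨by norm_num at h1 ⊢; linarith, by norm_num at h1 ⊢; linarith⟩ y' ?_).trans hKv2K
      refine mem_closedBall.2 ?_
      calc dist y' y ≤ dist y' w.2 + dist w.2 y := dist_triangle _ _ _
        _ ≤ 1 / 16 + 1 / 16 := add_le_add (mem_ball.1 hy').le hw2.le
        _ ≤ 1 := by norm_num
  -- the zooms agree with their representatives (and so do their spatial jets) on `Q(z, 7/8)`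
  have hEqSlice : ∀ j, J ≤ j → ∀ w ∈ ball (((-1 : ℝ), y) : ℝ × EuclideanSpace ℝ (Fin 3)) (1 / 16),
      (((lam j) • stPull ((lam j) ^ 2) (lam j) (0 : ℝ) (0 : (EuclideanSpace ℝ (Fin 3))) v') w.1) =ᶠ[𝓝 w.2] V j w.1 := by
    intro j hj w hw
    rw [hmemB] at hw
    obtain ⟨hw1, hw2⟩ := hw
    have h1 := abs_lt.1 hw1
    filter_upwards [ball_mem_nhds w.2 (by norm_num : (0 : ℝ) < 1 / 16)] with y' hy'
    refine hEqOn j hj (?_ : (w.1, y') ∈ parabolicCylinder (7 / 8) ((-(1 / 2) : ℝ), y))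
    rw [hmemQ]
    refine ⟨⟨by norm_num at h1 ⊢; linarith, by norm_num at h1 ⊢; linarith⟩, ?_⟩
    calc dist y' y ≤ dist y' w.2 + dist w.2 y := dist_triangle _ _ _
      _ < 1 / 16 + 1 / 16 := add_lt_add (mem_ball.1 hy') hw2
      _ < 7 / 8 := by norm_num
  refine ⟨fun ε hε => ?_, fun ε hε => ?_, ?_⟩
  · -- ## (U0) level zero, uniformly on `B((−1, y), 1/8)`
    filter_upwards [hU ε hε, eventually_ge_atTop J] with j hUj hJj w hw
    have he : ((lam j) • stPull ((lam j) ^ 2) (lam j) (0 : ℝ) (0 : (EuclideanSpace ℝ (Fin 3))) v') w.1 w.2 = V j w.1 w.2 :=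
      hEqOn j hJj (hS8sub hw)
    rw [he]
    exact hUj w hw
  · -- ## (U1) level one, uniformly on `B((−1, y), 1/16)`
    filter_upwards [hU1 (ε / 2) (half_pos hε), eventually_ge_atTop J] with j hUj hJj w hw
    rw [(hEqSlice j hJj w hw).fderiv_eq]
    calc ‖fderiv ℝ (V j w.1) w.2 - fderiv ℝ (v₁ w.1) w.2‖
        ≤ ‖iteratedFDeriv ℝ 1 (V j w.1) w.2 - iteratedFDeriv ℝ 1 (v₁ w.1) w.2‖ :=
          norm_fderiv_sub_le_iteratedFDeriv_one _ _ _
      _ ≤ ε / 2 := hUj w hw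
      _ < ε := half_lt_self hε
  · -- ## (H) level two at the point `(−1, y)`
    refine Metric.tendsto_nhds.2 fun ε hε => ?_
    obtain ⟨ρ, hρ0, hρh, hρK⟩ : ∃ ρ : ℝ, 0 < ρ ∧ ρ < 1 / 16 ∧ 2 * K * ρ ≤ ε / 4 := by
      refine ⟨min (1 / 32) (ε / (8 * (K + 1))), lt_min (by norm_num) (by positivity),
        lt_of_le_of_lt (min_le_left _ _) (by norm_num), ?_⟩
      calc 2 * K * min (1 / 32) (ε / (8 * (K + 1))) ≤ 2 * K * (ε / (8 * (K + 1))) := by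
            gcongr; exact min_le_right _ _
        _ = ε / 4 * (K / (K + 1)) := by field_simp; ring
        _ ≤ ε / 4 * 1 := by gcongr; exact (div_le_one (by positivity)).2 (by linarith)
        _ = ε / 4 := mul_one _
    set A : ℝ := ε * ρ / 8 with hAdef
    have hA0 : 0 < A := by positivity
    have hAρ : 2 * A / ρ = ε / 4 := by rw [hAdef]; field_simp; ring
    filter_upwards [hU1 A hA0, eventually_ge_atTop J] with j hUj hJj
    have hVj := hV j hJj
    have hmem0 : (((-1 : ℝ), y) : ℝ × EuclideanSpace ℝ (Fin 3)) ∈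
        ball (((-1 : ℝ), y) : ℝ × EuclideanSpace ℝ (Fin 3)) (1 / 16) := mem_ball_self (by norm_num)
    have hI := DerivInterp.norm_iteratedFDeriv_succ_sub_le (N := ((⊤ : ℕ∞) : WithTop ℕ∞)) (k := 1)
      (h := 1 / 16) (x := y) (f₁ := V j (-1)) (f₂ := v₁ (-1)) (A := A) (K := K)
      (fun y' hy' => hVj.2.1 ((-1 : ℝ), y') ?_) (fun y' _ => hslice_cd (-1) (by norm_num) y')
      (by rw [← WithTop.coe_natCast]; exact WithTop.coe_le_coe.2 le_top)
      (fun y' hy' => ?_) hK0 (fun y' hy' => ?_) (fun y' hy' => ?_) hρ0 hρh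
    · have hev : (((lam j) • stPull ((lam j) ^ 2) (lam j) (0 : ℝ) (0 : (EuclideanSpace ℝ (Fin 3))) v') (-1)) =ᶠ[𝓝 y]
          V j (-1) := hEqSlice j hJj ((-1 : ℝ), y) hmem0
      rw [dist_eq_norm, (hev.iteratedFDeriv ℝ 2).eq_of_nhds]
      calc ‖iteratedFDeriv ℝ 2 (V j (-1)) y - iteratedFDeriv ℝ 2 (v₁ (-1)) y‖
          ≤ 2 * A / ρ + 2 * K * ρ := hI
        _ ≤ ε / 4 + ε / 4 := by rw [hAρ]; exact add_le_add le_rfl hρK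
        _ < ε := by linarith
    · rw [hmemQ]
      exact ⟨⟨by norm_num, by norm_num⟩, lt_trans (mem_ball.1 hy') (by norm_num)⟩
    · exact hUj ((-1 : ℝ), y') (by rw [hmemB]; exact ⟨by norm_num, mem_ball.1 hy'⟩)
    · refine (((hVj.2.2 3 (7 / 8) h78).2 ((-1 : ℝ), y') ?_).trans hKr3)
      rw [hmemQ]
      exact ⟨⟨by norm_num, by norm_num⟩, lt_trans (mem_ball.1 hy') (by norm_num)⟩
    · exact (hKv3 (-1) ⟨by norm_num, by norm_num⟩ y'
        (mem_closedBall.2 (le_trans (mem_ball.1 hy').le (by norm_num)))).trans hKv3K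

end Summit.NavierStokesRegularity.NavierStokesRegularity.Theorems.LocalSineTubeDoorLocalPointZoomUniform

end
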